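import Summits.BirchSwinnertonDyer.BirchSwinnertonDyer.Theorems.ResidualThetaTransportAtTwoThetaLayerLambdaCongruenceAtTwoMuDictionary
import Literature.NumberTheory.EllipticCurves.PAdicLFunctionTameDepletionFactorProofs
import Literature.NumberTheory.EllipticCurves.PAdicLFunctionDistributionProofs
import HarnessLib

/-!
# Crux `ThetaLayerLambdaCongruenceAtTwo` (stmt-BirchSwinnertonDyer-20688), line `birth` v4: `μ`-PROPAGATION up the
# cyclotomic tower at `p = 2` for a newform with `a₂ = 0` — the sup norm of the layer element never decreases
# from layer `n` to layer `n + 2`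

Width seat bsd-wall-rtt-p3-w3 (`--supports stmt-BirchSwinnertonDyer-20688`; closes nothing). THEOREMS ONLY, route-independent.

## What is proved (for a newform `g` on `Γ₀(M)`, `2 ∤ M`, `a₂(g) = 0`, a plus period `Ω`, an embedding `ι : K_g → ℚ̄₂`)

* §1 `plusSymbolK_two_mul` — the HECKE RELATION AT `2` for the `K_g`-valued plus symbols (tree theorem
  `cuspCoeff_mul_plusSymbol`, Mazur–Tate–Teitelbaum §I.4 (4.2), with `a₂ = 0`):
  `[2r]⁺ = −[r/2]⁺ − [(r+1)/2]⁺`, i.e. `[x/2^m]⁺ = −[x/2^{m+2}]⁺ − [(x + 2^{m+1})/2^{m+2}]⁺`.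
* §2 `exists_layerSymbol_eq_of_odd` — every plus symbol `[a/2^{k+2}]⁺` with `a` odd IS a layer-`k` symbol
  `[5ˢ/2^{k+2}]⁺` (every odd residue mod `2^{k+2}` is `±5^e`, tree theorem `exists_rootsOfUnity_toZModPow_eq` at
  `p = 2`; `[−x]⁺ = [x]⁺`).
* §3 **`μ`-PROPAGATION** `supNorm_map_mazurTateElementK_two_le_add_two`: `‖θ_n(g;Ω)^ι‖_sup ≤ ‖θ_{n+2}(g;Ω)^ι‖_sup`
  for EVERY `n` — by the isometry `‖θ_n^ι‖ = ‖2‖·max_s ‖ι[5ˢ/2ⁿ⁺²]⁺‖` (`…MuDictionary`/`…SupNormIsometry`) and §1–§2: the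
  maximal layer-`n` symbol is minus the sum of two layer-`(n+2)` symbols. Hence (`…_le_add_two_mul`) the sup norms are
  non-decreasing along each parity class of layers, and at a COHOMOLOGICAL period (`‖θ_n^ι‖_sup ≤ ‖2‖` always,
  `…Doubling`): **if `‖θ_{n₁}(g;Ω)^ι‖_sup = ‖2‖₂` at ONE layer `n₁` then at ALL layers `n₁ + 2k`**
  (`supNorm_map_mazurTateElementK_two_eq_norm_two_of_le`) — the undepleted half of stub (μ♮) `stub_depletedLayerMuTwo`
  («`μ(ϑ_n(g)) = 0` for all large even `n`») is decided at a SINGLE even layer. (This is the easy direction of the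
  Kurihara/Perrin-Riou/Pollack–Weston `μ`-stabilisation `μ(θ_{n+1}) ≤ μ(θ_{n−1})` for `a_p = 0`, PW §4, read at `p = 2`.)

Nothing about any curve or form is asserted; BSD is not proved by any of this.

References: [MazurTateTeitelbaum1986Invent] §I.4 (4.2), §I.13; [PollackWeston2011MT] §3.1, §4 (three-term relation /
stabilisation, shape); [Serre1973] Ch. II §3.2 (structure of `ℤ₂^×`).
-/

noncomputable section

-- justification: the `Summit.BirchSwinnertonDyer.BirchSwinnertonDyer.…` path repeats a component (route-file convention)
set_option linter.dupNamespace false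

open scoped Classical

open Polynomial

open Literature.NumberTheory.IwasawaTheory Literature.NumberTheory.EllipticCurves
  Literature.NumberTheory.EllipticCurves.ModularForms

namespace Summit.BirchSwinnertonDyer.BirchSwinnertonDyer.Theorems.ThetaLayerLambdaCongruenceAtTwo

variable {M : ℕ} [NeZero M] {g : CuspForm (CongruenceSubgroup.Gamma0 M) 2}
  (ι : coeffField g →+* PadicAlgCl 2) (Ω : ℂ)

/-! ## §1. The Hecke relation at `2` for the `K_g`-valued plus symbols (`a₂ = 0`) -/

/-- **Hecke at `2` with `a₂(g) = 0`**: for a newform `g` on `Γ₀(M)`, `2 ∤ M`, `a₂(g) = 0` and a plus period `Ω`,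
`[2r]⁺_{g,Ω} = −([r/2]⁺_{g,Ω} + [(r+1)/2]⁺_{g,Ω})` in `K_g` — the tree's `cuspCoeff_mul_plusSymbol`
(`a₂·[r]⁺ = [r/2]⁺ + [(r+1)/2]⁺ + [2r]⁺`) divided by `Ω`. [cite: MazurTateTeitelbaum1986Invent, §I.4 (4.2)] -/
theorem plusSymbolK_two_mul (hg : IsNewform0 g) (h2M : ¬ 2 ∣ M) (ha2 : cuspCoeff g 2 = 0) (hΩ : IsPlusPeriod g Ω)
    (r : ℚ) : plusSymbolK g Ω (2 * r) = -(plusSymbolK g Ω (r / 2) + plusSymbolK g Ω ((r + 1) / 2)) := by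
  have h := cuspCoeff_mul_plusSymbol 2 hg Nat.prime_two h2M r
  rw [ha2, zero_mul, Fin.sum_univ_two] at h
  simp only [Fin.val_zero, Nat.cast_zero, add_zero, Fin.val_one, Nat.cast_one, Nat.cast_ofNat] at h
  apply Subtype.ext
  have e : (((-(plusSymbolK g Ω (r / 2) + plusSymbolK g Ω ((r + 1) / 2)) : coeffField g)) : ℂ) =
      -((((plusSymbolK g Ω (r / 2)) : coeffField g) : ℂ) + (((plusSymbolK g Ω ((r + 1) / 2)) : coeffField g) : ℂ)) := by
    push_cast
    ring
  rw [e, IsPlusPeriod.coe_plusSymbolK g hΩ, IsPlusPeriod.coe_plusSymbolK g hΩ, IsPlusPeriod.coe_plusSymbolK g hΩ]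
  have hΩ0 : Ω ≠ 0 := hΩ.1
  field_simp
  linear_combination -h

/-- The Hecke relation at `2` in "denominator" form: `[x/2^m]⁺ = −([x/2^{m+2}]⁺ + [(x + 2^{m+1})/2^{m+2}]⁺)`
(`r = x/2^{m+1}` in `plusSymbolK_two_mul`). [cite: MazurTateTeitelbaum1986Invent, §I.4 (4.2)] -/
theorem plusSymbolK_div_two_pow (hg : IsNewform0 g) (h2M : ¬ 2 ∣ M) (ha2 : cuspCoeff g 2 = 0)
    (hΩ : IsPlusPeriod g Ω) (x : ℚ) (m : ℕ) :
    plusSymbolK g Ω (x / (2 : ℚ) ^ m) =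
      -(plusSymbolK g Ω (x / (2 : ℚ) ^ (m + 2)) + plusSymbolK g Ω ((x + (2 : ℚ) ^ (m + 1)) / (2 : ℚ) ^ (m + 2))) := by
  have h := plusSymbolK_two_mul Ω hg h2M ha2 hΩ (x / (2 : ℚ) ^ (m + 1))
  have e1 : 2 * (x / (2 : ℚ) ^ (m + 1)) = x / (2 : ℚ) ^ m := by
    rw [pow_succ]; field_simp
  have e2 : x / (2 : ℚ) ^ (m + 1) / 2 = x / (2 : ℚ) ^ (m + 2) := by
    rw [pow_succ (2 : ℚ) (m + 1)]; field_simp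
  have e3 : (x / (2 : ℚ) ^ (m + 1) + 1) / 2 = (x + (2 : ℚ) ^ (m + 1)) / (2 : ℚ) ^ (m + 2) := by
    rw [pow_succ (2 : ℚ) (m + 1)]; field_simp
  rw [e1, e2, e3] at h
  exact h

/-! ## §2. Every `[a/2^{k+2}]⁺` with `a` odd is a layer-`k` symbol `[5ˢ/2^{k+2}]⁺` -/

/-- The `2`-adic roots of unity of order dividing `t = 2` (e.g. `t = torsionOrder 2`) are `±1` (private helper).
[folklore] -/
private theorem coe_rootsOfUnity_eq_or_of_eq_two {t : ℕ} (ht : t = 2) (ξ : rootsOfUnity t ℤ_[2]) :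
    ((ξ : ℤ_[2]ˣ) : ℤ_[2]) = 1 ∨ ((ξ : ℤ_[2]ˣ) : ℤ_[2]) = -1 := by
  subst ht
  have h := ξ.2
  rw [mem_rootsOfUnity] at h
  have h' : (((ξ : ℤ_[2]ˣ) : ℤ_[2])) ^ 2 = 1 := by
    rw [← Units.val_pow_eq_pow_val, h, Units.val_one]
  exact sq_eq_one_iff.mp h'

/-- **Every odd residue is a layer symbol argument**: for `a` odd and every `k`, the plus symbol at
`(a mod 2^{k+2})/2^{k+2}` equals a layer-`k` symbol `[5ˢ/2^{k+2}]⁺_{g,Ω}` for some `s mod 2^k` — since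
`(ℤ/2^{k+2})ˣ = {±1} × ⟨5⟩` (`exists_rootsOfUnity_toZModPow_eq` at `p = 2`) and `[(−y).val/2^{k+2}]⁺ = [y.val/2^{k+2}]⁺`
(`plusSymbolK_neg_val_div`). [cite: Serre1973, Ch. II §3.2 Prop. 8] -/
theorem exists_layerSymbol_eq_of_odd (k : ℕ) {a : ℕ} (ha : Odd a) :
    ∃ s : ZMod (2 ^ k), plusSymbolK g Ω ((((a : ZMod (2 ^ (k + 2))).val : ℕ) : ℚ) / (2 : ℚ) ^ (k + 2)) =
      plusSymbolK g Ω (((((cyclotomicGenerator 2 : ZMod (2 ^ (k + 2))) ^ s.val).val : ℕ) : ℚ) /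
        (2 : ℚ) ^ (k + 2)) := by
  -- an odd natural number is a unit of `ℤ₂` (as in `DepletionAtTwo.isUnit_natCast_of_odd`)
  have hu : IsUnit (a : ℤ_[2]) :=
    PadicInt.isUnit_iff.mpr (PadicInt.norm_natCast_eq_one_iff.mpr (Nat.coprime_two_left.mpr ha))
  obtain ⟨teich, hteich⟩ := exists_rootsOfUnity_toZModPow_eq 2 hu.unit
  have h : PadicInt.toZModPow (k + 2) ((teich : ℤ_[2]ˣ) : ℤ_[2]) *
      (cyclotomicGenerator 2 : ZMod (2 ^ (k + 2))) ^ (PadicInt.toZModPow k (CyclotomicZp.ell 2 hu.unit)).val =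
        (a : ZMod (2 ^ (k + 2))) := by
    have := hteich k
    rw [IsUnit.unit_spec, map_natCast] at this
    exact this
  refine ⟨PadicInt.toZModPow k (CyclotomicZp.ell 2 hu.unit), ?_⟩
  rcases coe_rootsOfUnity_eq_or_of_eq_two torsionOrder_two teich with h1 | h1
  · rw [h1, map_one, one_mul] at h
    rw [← h]
  · rw [h1, map_neg, map_one, neg_one_mul] at h
    rw [← h, plusSymbolK_neg_val_div]

/-! ## §3. `μ`-propagation: `‖θ_n(g;Ω)^ι‖_sup ≤ ‖θ_{n+2}(g;Ω)^ι‖_sup` -/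

/-- **`μ`-PROPAGATION at `p = 2` for `a₂ = 0`.** For a newform `g` on `Γ₀(M)` with `2 ∤ M`, `a₂(g) = 0`, a plus
period `Ω` and any embedding `ι : K_g → ℚ̄₂`: `‖θ_n(g;Ω)^ι‖_sup ≤ ‖θ_{n+2}(g;Ω)^ι‖_sup` for every `n`. PROOF: by the
isometry both sides are `‖2‖·(max over the layer symbols)`; a maximal layer-`n` symbol `[a/2ⁿ⁺²]⁺` equals
`−([a/2ⁿ⁺⁴]⁺ + [(a + 2ⁿ⁺³)/2ⁿ⁺⁴]⁺)` (Hecke at `2`, `a₂ = 0`), a sum of two layer-`(n+2)` symbols (odd numerators),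
so its norm is at most the layer-`(n+2)` maximum (ultrametric inequality). (Kurihara/Perrin-Riou/PW: `μ(θ_{n+1}) ≤
μ(θ_{n−1})` from the three-term relation with `a_p = 0`, read at `2`.) [cite: PollackWeston2011MT, §4 (three-term relation, a_p = 0; shape)] -/
theorem supNorm_map_mazurTateElementK_two_le_add_two (hg : IsNewform0 g) (h2M : ¬ 2 ∣ M)
    (ha2 : cuspCoeff g 2 = 0) (hΩ : IsPlusPeriod g Ω) (n : ℕ) :
    ((mazurTateElementK g Ω 2 n).map ι).supNorm ≤ ((mazurTateElementK g Ω 2 (n + 2)).map ι).supNorm := by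
  haveI : NeZero (2 ^ n) := ⟨pow_ne_zero _ two_ne_zero⟩
  haveI : NeZero (2 ^ (n + 2)) := ⟨pow_ne_zero _ two_ne_zero⟩
  rw [supNorm_map_mazurTateElementK_two_eq, supNorm_map_mazurTateElementK_two_eq]
  refine mul_le_mul_of_nonneg_left ?_ (norm_nonneg _)
  -- the layer symbols as functions
  set c : ZMod (2 ^ n) → PadicAlgCl 2 := fun s ↦ ι (plusSymbolK g Ω
    (((((cyclotomicGenerator 2 : ZMod (2 ^ (n + 2))) ^ s.val).val : ℕ) : ℚ) / (2 : ℚ) ^ (n + 2))) with hc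
  set c' : ZMod (2 ^ (n + 2)) → PadicAlgCl 2 := fun s ↦ ι (plusSymbolK g Ω
    (((((cyclotomicGenerator 2 : ZMod (2 ^ (n + 2 + 2))) ^ s.val).val : ℕ) : ℚ) / (2 : ℚ) ^ (n + 2 + 2))) with hc'
  have hS : (∑ s : ZMod (2 ^ n), C (ι (plusSymbolK g Ω
      (((((cyclotomicGenerator 2 : ZMod (2 ^ (n + 2))) ^ s.val).val : ℕ) : ℚ) / (2 : ℚ) ^ (n + 2)))) *
        (X + 1) ^ s.val) = ∑ s : ZMod (2 ^ n), C (c s) * (X + 1) ^ s.val := by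
    simp only [hc]
  have hS' : (∑ s : ZMod (2 ^ (n + 2)), C (ι (plusSymbolK g Ω
      (((((cyclotomicGenerator 2 : ZMod (2 ^ (n + 2 + 2))) ^ s.val).val : ℕ) : ℚ) / (2 : ℚ) ^ (n + 2 + 2)))) *
        (X + 1) ^ s.val) = ∑ s : ZMod (2 ^ (n + 2)), C (c' s) * (X + 1) ^ s.val := by
    simp only [hc']
  rw [hS, hS']
  -- a maximal layer-`n` symbol
  obtain ⟨s₀, hs₀⟩ := exists_supNorm_sum_C_mul_X_add_one_pow_eq c
  rw [hs₀]
  -- its numerator `a`, odd and `< 2^{n+2}`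
  set a : ℕ := ((cyclotomicGenerator 2 : ZMod (2 ^ (n + 2))) ^ s₀.val).val with ha
  -- the residues `5ˢ mod 2^{n+2}` are odd (as in `Rank2.SymbolParityAtTwo.odd_val_cyclotomicGenerator_pow`)
  have haodd : Odd a := by
    have h5 : (cyclotomicGenerator 2 : ZMod (2 ^ (n + 2))) ^ s₀.val = ((5 ^ s₀.val : ℕ) : ZMod (2 ^ (n + 2))) := by
      simp [cyclotomicGenerator, cyclotomicExponent]
    rw [ha, h5, ZMod.val_natCast, Nat.odd_iff, Nat.mod_mod_of_dvd _ (dvd_pow_self 2 (by omega))]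
    exact Nat.odd_iff.mp (Odd.pow (by decide))
  have halt : a < 2 ^ (n + 2) := ZMod.val_lt _
  have hpow : 2 ^ (n + 2) ≤ 2 ^ (n + 2 + 1) := Nat.pow_le_pow_right (by norm_num) (by omega)
  have hpow' : 2 ^ (n + 2 + 1) + 2 ^ (n + 2 + 1) = 2 ^ (n + 2 + 2) := by rw [pow_succ]; ring
  have halt4 : a < 2 ^ (n + 2 + 2) := by omega
  have hblt4 : a + 2 ^ (n + 2 + 1) < 2 ^ (n + 2 + 2) := by omega
  have hbodd : Odd (a + 2 ^ (n + 2 + 1)) := by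
    rw [pow_succ]
    exact haodd.add_even (even_two.mul_left _)
  -- Hecke at `2`: `[a/2^{n+2}]⁺ = −([a/2^{n+4}]⁺ + [(a+2^{n+3})/2^{n+4}]⁺)`
  have hH := plusSymbolK_div_two_pow Ω hg h2M ha2 hΩ (a : ℚ) (n + 2)
  -- both summands are layer-`(n+2)` symbols
  obtain ⟨s₁, hs₁⟩ := exists_layerSymbol_eq_of_odd (g := g) Ω (n + 2) haodd
  obtain ⟨s₂, hs₂⟩ := exists_layerSymbol_eq_of_odd (g := g) Ω (n + 2) hbodd
  rw [ZMod.val_natCast_of_lt halt4] at hs₁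
  rw [ZMod.val_natCast_of_lt hblt4] at hs₂
  push_cast at hs₂
  have hcs₀ : c s₀ = -(c' s₁ + c' s₂) := by
    simp only [hc, hc']
    rw [← hs₁, ← hs₂, ← map_add, ← map_neg, ← hH]
  rw [hcs₀, norm_neg]
  refine (IsUltrametricDist.norm_add_le_max _ _).trans (max_le ?_ ?_)
  · exact norm_le_supNorm_sum_C_mul_X_add_one_pow c' s₁
  · exact norm_le_supNorm_sum_C_mul_X_add_one_pow c' s₂

/-- Iterated `μ`-propagation: `‖θ_n(g;Ω)^ι‖_sup ≤ ‖θ_{n+2k}(g;Ω)^ι‖_sup` — the sup norms of the layer elements are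
non-decreasing along each parity class of layers. [cite: PollackWeston2011MT, §4 (shape)] -/
theorem supNorm_map_mazurTateElementK_two_le_add_two_mul (hg : IsNewform0 g) (h2M : ¬ 2 ∣ M)
    (ha2 : cuspCoeff g 2 = 0) (hΩ : IsPlusPeriod g Ω) (n k : ℕ) :
    ((mazurTateElementK g Ω 2 n).map ι).supNorm ≤ ((mazurTateElementK g Ω 2 (n + 2 * k)).map ι).supNorm := by
  induction k with
  | zero => simp
  | succ k ih =>
    have e : n + 2 * (k + 1) = n + 2 * k + 2 := by ring
    rw [e]
    exact ih.trans (supNorm_map_mazurTateElementK_two_le_add_two ι Ω hg h2M ha2 hΩ (n + 2 * k))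

variable {ι Ω}

/-- **(μ♮) undepleted is decided at ONE layer.** At a COHOMOLOGICAL plus period `Ω` (where `‖θ_m(g;Ω)^ι‖_sup ≤ ‖2‖` at
every layer, `supNorm_map_mazurTateElementK_two_le`): if `‖θ_{n₁}(g;Ω)^ι‖_sup = ‖2‖₂` at one layer `n₁` — i.e. some
layer-`n₁` plus symbol is a unit, `μ(ϑ_{n₁}) = 0` — then `‖θ_{n₁+2k}(g;Ω)^ι‖_sup = ‖2‖₂` at EVERY layer `n₁ + 2k`
(`μ(ϑ_n) = 0` for all `n ≥ n₁` of the same parity). [cite: PollackWeston2011MT, §4 (μ-stabilisation, a_p = 0; shape)] -/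
theorem supNorm_map_mazurTateElementK_two_eq_norm_two_of_le (hg : IsNewform0 g) (h2M : ¬ 2 ∣ M)
    (ha2 : cuspCoeff g 2 = 0) (h : IsCohomologicalPlusPeriod g ι Ω) {n₁ : ℕ}
    (hn₁ : ((mazurTateElementK g Ω 2 n₁).map ι).supNorm = ‖(2 : PadicAlgCl 2)‖) (k : ℕ) :
    ((mazurTateElementK g Ω 2 (n₁ + 2 * k)).map ι).supNorm = ‖(2 : PadicAlgCl 2)‖ :=
  le_antisymm (supNorm_map_mazurTateElementK_two_le h _)
    (hn₁ ▸ supNorm_map_mazurTateElementK_two_le_add_two_mul ι Ω hg h2M ha2 h.isPlusPeriod n₁ k)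

/-- Symbol form of the propagation: at a cohomological period, a UNIT layer-`n` plus symbol forces a unit layer-`(n+2k)`
plus symbol for every `k` (`…MuDictionary.supNorm_map_mazurTateElementK_two_eq_norm_two_iff`). [cite: PollackWeston2011MT, §4 (shape)] -/
theorem exists_unit_layerSymbol_add_two_mul (hg : IsNewform0 g) (h2M : ¬ 2 ∣ M) (ha2 : cuspCoeff g 2 = 0)
    (h : IsCohomologicalPlusPeriod g ι Ω) {n : ℕ}
    (hn : ∃ s : ZMod (2 ^ n), ‖ι (plusSymbolK g Ω
      (((((cyclotomicGenerator 2 : ZMod (2 ^ (n + 2))) ^ s.val).val : ℕ) : ℚ) / (2 : ℚ) ^ (n + 2)))‖ = 1) (k : ℕ) :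
    ∃ s : ZMod (2 ^ (n + 2 * k)), ‖ι (plusSymbolK g Ω
      (((((cyclotomicGenerator 2 : ZMod (2 ^ (n + 2 * k + 2))) ^ s.val).val : ℕ) : ℚ) /
        (2 : ℚ) ^ (n + 2 * k + 2)))‖ = 1 :=
  (supNorm_map_mazurTateElementK_two_eq_norm_two_iff h (n + 2 * k)).mp
    (supNorm_map_mazurTateElementK_two_eq_norm_two_of_le hg h2M ha2 h
      ((supNorm_map_mazurTateElementK_two_eq_norm_two_iff h n).mpr hn) k)

end Summit.BirchSwinnertonDyer.BirchSwinnertonDyer.Theorems.ThetaLayerLambdaCongruenceAtTwo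

end
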